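import Summits.CriticalPhenomena.SAWScalingLimit.Theorems.SAWLoopFugacityFlowIsingBoundaryRatioRimWiredComparison
import Summits.CriticalPhenomena.SAWScalingLimit.Theorems.SAWLoopFugacityFlowIsingBoundaryRatioWindowResistanceDefs
import Summits.CriticalPhenomena.SAWScalingLimit.Theorems.SAWLoopFugacityFlowIsingBoundaryRatioWindowCrossingDefs
import HarnessLib

/-!
# The rim-to-rim crossing bound in large modulus from CDH16 Thm 1.1 (ii)
(line `fk-anchor-transfer` of the crux `SAWLoopFugacityFlow.IsingBoundaryRatio`, stmt-CriticalPhenomena-10650;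
registered stub `halfAnnulusRimCrossingBoundLarge_of'`)

`HalfAnnulusRimCrossingBoundLarge` (…WindowRectDefs) is derived from
* CDH16 Thm 1.1 (ii) (`fkIsing_topologicalRectangle_crossingBounds`, named fact), the sandwich and the
  self-duality of the external extremal lengths (`discreteEL_ext_sandwich`, `discreteEL_ext_selfDual`, named facts,
  CDH16 §3.3);
* the three lattice TARGETS of the line: the window of the lattice conformal half-annulus is presented as a
  discrete topological rectangle (`WindowRectPresentation`), its external side-to-side resistance is
  `≤ C / log (r₂'/r₁')` (`WindowExtResistanceBound`), and every open radial crossing of the annulus contains an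
  open crossing of the rectangle between the arcs `1` and `3` (`AnnCrossThroughWindowRect`).

Plumbing. Radii `r₁ = M^{1/5}ρ < r₁' = M^{2/5}ρ < r₂' = M^{3/5}ρ < r₂ = M^{4/5}ρ`, so `log (r₂'/r₁') = (log M)/5`
and `ℓ_Ω̄[(sides)] ≤ 5C / log M`; self-duality gives `ℓ_Ω̄[(rims)] ≥ C_d⁻¹ log M / (5C)`; rotating the
presentation by one arc (`isRect_rotate_rim`: the rims become the arcs `0`, `2`) and the sandwich give
`ℓ_Ω[(rims)] ≥ C_d⁻¹ log M / (5C) − 4(2√2−1) ≥ 1` for `M ≥ M₀ := exp (5 C C_d (1 + 4(2√2−1)))`, whence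
Thm 1.1 (ii) with `L = 1`: the fully wired measure of `⟨E⟩` gives the open crossing between the rims
probability `≤ 1 − η(1)`. Finally the wired local measure of the annulus is dominated on that increasing event by
the fully wired measure of `⟨E⟩` (`real_walkEvent_le_fkMeasure_rim`: comparison of boundary conditions, domain
Markov, transfer of vertex types), and the radial crossing event is contained in it (`AnnCrossThroughWindowRect`).
-/

noncomputable section

open scoped Classical Topology ENNReal
open Filter Set Metric SimpleGraph MeasureTheory
open Literature.Probability.LatticeModels Literature.Probability.RandomPlanarGeometry
open Literature.Probability.Percolation (BondConfig openCrossing)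
open UpperHalfPlane (upperHalfPlaneSet)

namespace Summit.CriticalPhenomena.SAWScalingLimit.Theorems.IsingBoundaryRatio

/-- **The resistance arithmetic of CDH16 §3.3** in `ℝ≥0∞`: from the self-duality lower bound
`C_d⁻¹ ≤ ℓ̄(0,2) ℓ̄(1,3)`, the side bound `ℓ̄(0,2) ≤ B` and the sandwich `ℓ̄(1,3) ≤ ℓ + κ`, if `1 + κ ≤ C_d⁻¹/B`
then `ℓ ≥ 1 = 1⁻¹`. [cite: ChelkakDuminilCopinHongler2016, §3.3] -/
theorem one_le_rimResistance_rim {R₀₂ R₁₃ ℓ : ℝ≥0∞} {Cd B κ : ℝ} (hB : 0 < B) (hκ : 0 ≤ κ)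
    (hsd : ENNReal.ofReal Cd⁻¹ ≤ R₀₂ * R₁₃) (h₀₂ : R₀₂ ≤ ENNReal.ofReal B)
    (hsw : R₁₃ ≤ ℓ + ENNReal.ofReal κ) (hlarge : 1 + κ ≤ Cd⁻¹ / B) :
    ENNReal.ofReal 1⁻¹ ≤ ℓ := by
  have h1 : ENNReal.ofReal Cd⁻¹ ≤ ENNReal.ofReal B * R₁₃ := hsd.trans (mul_le_mul_left h₀₂ _)
  have h2 : ENNReal.ofReal (Cd⁻¹ / B) ≤ R₁₃ := by
    rw [ENNReal.ofReal_div_of_pos hB]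
    exact ENNReal.div_le_of_le_mul' h1
  have h3 : ENNReal.ofReal (Cd⁻¹ / B) - ENNReal.ofReal κ ≤ ℓ := tsub_le_iff_right.2 (h2.trans hsw)
  calc ENNReal.ofReal 1⁻¹ = ENNReal.ofReal 1 := by rw [inv_one]
    _ ≤ ENNReal.ofReal (Cd⁻¹ / B - κ) := ENNReal.ofReal_le_ofReal (by linarith)
    _ = ENNReal.ofReal (Cd⁻¹ / B) - ENNReal.ofReal κ := ENNReal.ofReal_sub _ hκ
    _ ≤ ℓ := h3

/-- The radii `M^{k/5} ρ`, `k = 1, …, 4`, are nested strictly between `ρ` and `Mρ` for `M > 1`. [folklore] -/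
theorem radii_chain_rim {M ρ : ℝ} (hM : 1 < M) (hρ : 0 < ρ) :
    ρ < M ^ (1 / 5 : ℝ) * ρ ∧ M ^ (1 / 5 : ℝ) * ρ < M ^ (2 / 5 : ℝ) * ρ ∧
      M ^ (2 / 5 : ℝ) * ρ < M ^ (3 / 5 : ℝ) * ρ ∧ M ^ (3 / 5 : ℝ) * ρ < M ^ (4 / 5 : ℝ) * ρ ∧
      M ^ (4 / 5 : ℝ) * ρ < M * ρ := by
  refine ⟨?_, ?_, ?_, ?_, ?_⟩
  · have := Real.one_lt_rpow hM (by norm_num : (0 : ℝ) < 1 / 5)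
    nlinarith
  · exact mul_lt_mul_of_pos_right (Real.rpow_lt_rpow_of_exponent_lt hM (by norm_num)) hρ
  · exact mul_lt_mul_of_pos_right (Real.rpow_lt_rpow_of_exponent_lt hM (by norm_num)) hρ
  · exact mul_lt_mul_of_pos_right (Real.rpow_lt_rpow_of_exponent_lt hM (by norm_num)) hρ
  · have := Real.rpow_lt_rpow_of_exponent_lt hM (show (4 / 5 : ℝ) < 1 by norm_num)
    rw [Real.rpow_one] at this
    exact mul_lt_mul_of_pos_right this hρ

/-- `log (M^{3/5}ρ / (M^{2/5}ρ)) = (log M)/5`. [folklore] -/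
theorem log_radii_ratio_rim {M ρ : ℝ} (hM : 0 < M) (hρ : 0 < ρ) :
    Real.log (M ^ (3 / 5 : ℝ) * ρ / (M ^ (2 / 5 : ℝ) * ρ)) = Real.log M / 5 := by
  rw [mul_div_mul_right _ _ hρ.ne', ← Real.rpow_sub hM, Real.log_rpow hM]
  ring

/-- A lattice neighbour is reached by one of the four directions `DiscreteRect.dir`. [folklore] -/
theorem exists_dir_of_zdGraph_adj_rim {x y : Site 2} (h : (zdGraph 2).Adj x y) :
    ∃ k : Fin 4, y = x + DiscreteRect.dir k := by
  obtain ⟨i, h | h⟩ := (zdGraph_adj_iff x y).1 h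
  · fin_cases i
    · exact ⟨0, h⟩
    · exact ⟨1, h⟩
  · fin_cases i
    · have h' : x = y + Pi.single 0 1 := h
      refine ⟨2, ?_⟩
      rw [h', show DiscreteRect.dir 2 = -Pi.single 0 1 from rfl]
      abel
    · have h' : x = y + Pi.single 1 1 := h
      refine ⟨3, ?_⟩
      rw [h', show DiscreteRect.dir 3 = -Pi.single 1 1 from rfl]
      abel

/-- **The rim-to-rim crossing bound in LARGE-MODULUS form from CDH16 Thm 1.1 (ii)** (see the module docstring;
registered sub-goal `halfAnnulusRimCrossingBoundLarge_of'` of stmt-CriticalPhenomena-10650). [folklore] -/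
theorem halfAnnulusRimCrossingBoundLarge_of' : fkIsing_topologicalRectangle_crossingBounds → discreteEL_ext_sandwich → discreteEL_ext_selfDual → WindowRectPresentation → WindowExtResistanceBound → AnnCrossThroughWindowRect → HalfAnnulusRimCrossingBoundLarge := by
  intro hCDH hsand hsd hpres hres hcross D φ hφ
  obtain ⟨C, hC, hresC⟩ := hres D φ hφ
  obtain ⟨Cd, hCd1, hsdC⟩ := hsd
  obtain ⟨η, hη, -, hCDH1⟩ := hCDH 1 one_pos
  have hCd : 0 < Cd := one_pos.trans_le hCd1
  -- the sandwich constant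
  set κ : ℝ := 4 * (2 * Real.sqrt 2 - 1) with hκdef
  have hκ : 0 ≤ κ := by
    have : (1 : ℝ) ≤ Real.sqrt 2 := Real.one_le_sqrt.2 (by norm_num)
    rw [hκdef]
    nlinarith
  -- the large modulus
  refine ⟨Real.exp (5 * C * Cd * (1 + κ)), Real.one_lt_exp_iff.2 (by positivity), fun M hM => ?_⟩
  have hM1 : 1 < M := lt_of_lt_of_le (Real.one_lt_exp_iff.2 (by positivity)) hM
  have hM0 : 0 < M := one_pos.trans hM1
  have hlogM : 5 * C * Cd * (1 + κ) ≤ Real.log M := by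
    rw [← Real.log_exp (5 * C * Cd * (1 + κ))]
    exact Real.log_le_log (Real.exp_pos _) hM
  have hlogM0 : 0 < Real.log M := Real.log_pos hM1
  refine ⟨η, hη, fun ε hε => ?_⟩
  obtain ⟨ρ₁, hρ₁, h1⟩ := hpres D φ hφ M hM1 ε hε
  obtain ⟨ρ₂, hρ₂, h2⟩ := hresC M hM1 ε hε
  obtain ⟨ρ₃, hρ₃, h3⟩ := hcross D φ hφ M hM1 ε hε
  refine ⟨min ρ₁ (min ρ₂ ρ₃), lt_min hρ₁ (lt_min hρ₂ hρ₃), fun ρ hρ hρlt => ?_⟩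
  have hρ1 : ρ < ρ₁ := hρlt.trans_le (min_le_left _ _)
  have hρ2 : ρ < ρ₂ := hρlt.trans_le ((min_le_right _ _).trans (min_le_left _ _))
  have hρ3 : ρ < ρ₃ := hρlt.trans_le ((min_le_right _ _).trans (min_le_right _ _))
  obtain ⟨c1, c2, c3, c4, c5⟩ := radii_chain_rim hM1 hρ
  filter_upwards [h1 ρ hρ hρ1 _ _ _ _ c1 c2 c3 c4 c5, h2 ρ hρ hρ2 _ _ _ _ c1 c2 c3 c4 c5,
    h3 ρ hρ hρ3 _ _ _ _ c1 c2 c3 c4 c5] with δ hδ1 hδ2 hδ3 Λ hLA hdisc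
  intro H In Ann
  obtain ⟨E, d₀, n, hW⟩ := hδ1 Λ hLA hdisc
  have hR02 := hδ2 Λ hLA hdisc E d₀ n hW
  have hwalk := hδ3 Λ hLA hdisc E d₀ n hW
  rw [log_radii_ratio_rim hM0 hρ] at hR02
  -- the rectangle with the rims as arcs `0`, `2`
  have hrect := isRect_rotate_rim hW.isRect
  obtain ⟨hsd1, -⟩ := hsdC E d₀ n hW.isRect
  obtain ⟨-, hsw⟩ := hsand E _ _ hrect
  rw [extResistance_rotate_rim] at hsw
  have hlarge : 1 + κ ≤ Cd⁻¹ / (C / (Real.log M / 5)) := by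
    rw [show Cd⁻¹ / (C / (Real.log M / 5)) = Real.log M / (5 * C * Cd) by field_simp]
    rw [le_div_iff₀ (by positivity)]
    linarith
  have hℓ := one_le_rimResistance_rim (div_pos hC (by positivity)) hκ hsd1 hR02 hsw hlarge
  have hii : (DiscreteRect.fkMeasure E {x | x.1 ∈ DiscreteRect.bdVerts E}).real
      (openCrossing Set.univ {x | x.1 ∈ DiscreteRect.arcVerts E d₀ n 1}
        {x | x.1 ∈ DiscreteRect.arcVerts E d₀ n 3}) ≤ 1 - η := by
    have := (hCDH1 E _ _ hrect).2 hℓ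
    rwa [(arcVerts_rotate_rim E d₀ n).1, (arcVerts_rotate_rim E d₀ n).2] at this
  -- the hypotheses of the comparison lemma
  have hsub : DiscreteRect.verts E ⊆ Λ := by
    intro x hx
    obtain ⟨y, hy⟩ := exists_mem_of_mem_verts_rim hx
    exact (hW.mem_window _ hy x (Sym2.mem_mk_left _ _)).1
  have hadj : ∀ (x y : Site 2) (hx : x ∈ Λ) (hy : y ∈ Λ), s(x, y) ∈ E → H.Adj ⟨x, hx⟩ ⟨y, hy⟩ := by
    intro x y hx hy he
    show (discreteDomainGraph D.carrier δ).Adj x y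
    exact (SimpleGraph.mem_edgeSet _).1 (hW.mem_edgeSet _ he)
  have hann : ∀ (x : Site 2) (hx : x ∈ DiscreteRect.verts E), (⟨x, hsub hx⟩ : Λ) ∈ Ann := by
    intro x hx
    obtain ⟨y, hy⟩ := exists_mem_of_mem_verts_rim hx
    obtain ⟨hx', hxw⟩ := hW.mem_window _ hy x (Sym2.mem_mk_left _ _)
    exact annWindow_subset_annBody D φ M ε δ ρ _ _ Λ hxw
  have hlat : ∀ u v : Λ, H.Adj u v → ∃ k : Fin 4, v.1 = u.1 + DiscreteRect.dir k := by
    intro u v huv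
    have huv' : (discreteDomainGraph D.carrier δ).Adj u.1 v.1 := huv
    exact exists_dir_of_zdGraph_adj_rim (meshGraph_adj_iff.1 (discreteDomainGraph_adj_iff.1 huv').1).1
  have hbd : ∃ x ∈ DiscreteRect.verts E, x ∈ DiscreteRect.bdVerts E :=
    ⟨d₀.1, hW.isRect.isExtDart.1, d₀.2, by rw [Prod.mk.eta]; exact hW.isRect.isExtDart⟩
  have hA : DiscreteRect.arcVerts E d₀ n 1 ⊆ ↑(DiscreteRect.verts E) :=
    fun x hx => (arcVerts_subset_rim hW.isRect.isExtDart 1 hx).1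
  have hC' : DiscreteRect.arcVerts E d₀ n 3 ⊆ ↑(DiscreteRect.verts E) :=
    fun x hx => (arcVerts_subset_rim hW.isRect.isExtDart 3 hx).1
  have hcomp := real_walkEvent_le_fkMeasure_rim H Ann E hsub hadj hann hlat hbd hA hC'
  -- the radial crossing event is contained in the walk event
  have hincl : {ω : BondConfig Λ | AnnCross H In Ann ω} ⊆
      {ω | ∃ u ∈ DiscreteRect.arcVerts E d₀ n 1, ∃ v ∈ DiscreteRect.arcVerts E d₀ n 3,
        ∃ p : (fromEdgeSet (↑E : Set (Sym2 (Site 2)))).Walk u v,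
          ∀ e ∈ p.edges, ∃ (x y : Site 2) (hx : x ∈ Λ) (hy : y ∈ Λ),
            e = s(x, y) ∧ s((⟨x, hx⟩ : Λ), ⟨y, hy⟩) ∈ ω} := by
    intro ω hω
    obtain ⟨u, v, hu, hv, p, hp⟩ := hwalk ω hω
    exact ⟨u, hu, v, hv, p, hp⟩
  -- assembly
  rw [show (1 : ℝ) - Real.exp (-2 * criticalBetaTwo) = criticalFKIsingParam from fkIsingParam_half_log]
  haveI := isProbabilityMeasure_rcMeasure (fromEdgeSet (↑(annEdgeFinset H Ann) : Set (Sym2 Λ)))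
    criticalFKIsingParam_mem_Icc two_pos Annᶜ
  exact ((measureReal_mono hincl).trans hcomp).trans hii

end Summit.CriticalPhenomena.SAWScalingLimit.Theorems.IsingBoundaryRatio

end
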